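import Mathlib.Analysis.InnerProductSpace.Adjoint
import Mathlib.Analysis.InnerProductSpace.PiL2
import Mathlib.Topology.Algebra.Group.ClosedSubgroup
import Mathlib.Topology.Algebra.MvPolynomial
import Mathlib.Topology.Instances.Matrix
import Mathlib.LinearAlgebra.UnitaryGroup
import Mathlib.Analysis.Complex.Polynomial.Basic
import Literature.NumberTheory.Automorphic.TorusCharacters
import Literature.NumberTheory.Automorphic.TorusRigidity
import Literature.NumberTheory.Automorphic.ZariskiGL
import HarnessLib

/-!
# Zariski closures of compact (unitary) matrix groups: connectedness, self-adjointness, tori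

Topic `RepresentationTheory/CompactGroups`. Bridges between the Euclidean topology of `GL n ℂ`
and the tree's concrete theory of linear algebraic groups over `ℂ`
(`Literature.NumberTheory.Automorphic`: `IsAlgebraicSubgroup`, `zariskiClosure`, `IsZConnected`,
`IsTorusSubgroup`), used for the element with abelian centraliser of a compact connected linear
group (`ExistsAbelianCentralizer`). All proved:

* `isSemisimpleElt_of_mem_unitaryGroup` — a unitary matrix is a semisimple element of `GL n ℂ`
  (every invariant subspace has the invariant complement `pᗮ`);
* `isClosed_of_isAlgebraicSubgroup` — algebraic subgroups are closed in the Euclidean topology;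
  `isZConnected_zariskiClosure_of_isPreconnected` — **the Zariski closure of a (Euclidean)
  connected subgroup is Zariski connected** (an algebraic subgroup of finite index is Euclidean
  clopen in the closure, so it contains the connected group);
* `continuous_star_zariski`, `star_mem_zariskiClosure`, `star_mem_centralizer`,
  `star_eq_inv_of_mem_unitaryGroup` — `g ↦ g⋆` is Zariski continuous, so Zariski closures and
  centralisers of self-adjoint sets are self-adjoint, and unitary groups are self-adjoint;
* `isMulCommutative_zariskiClosure`, `isTorusSubgroup_zariskiClosure` — the Zariski closure of a
  connected commutative group of unitary matrices is a torus (commutative by the commutator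
  estimate `⁅Ā, Ā⁆ ≤ cl ⁅A, A⁆`, semisimple because `A` is conjugate into the diagonal torus);
* `exists_zeroLocusGL_eq_biUnion_smul` — a finite union of translates of an algebraic subgroup is
  a zero locus; `eval_eq_zero_of_mem_zariskiClosure` — polynomials vanishing on `A` vanish on `Ā`.

The Zariski topology (the tree's `zariskiTopologyGL`, a `def`) is only ever introduced inside
proofs (`letI`) or named explicitly (`Continuous[_, _]`); the ambient topology of `GL n ℂ` in all
statements is the Euclidean one.

Sources: C. Chevalley, *Theory of Lie Groups I* (1946), Ch. VI; A. L. Onishchik, E. B. Vinberg,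
*Lie Groups and Algebraic Groups* (1990), Ch. 3 §§1–2 and Ch. 5 §2; T. A. Springer, *Linear
Algebraic Groups* (1998), 2.2.1, 2.2.4. Mathlib supplies the inner-product and semisimplicity
API (`Module.End.isSemisimple_iff`, `LinearEquiv.isSemisimple_iff`,
`Matrix.toEuclideanLin_conjTranspose_eq_adjoint`) and `Subgroup.isOpen_of_isClosed_of_finiteIndex`.
-/

noncomputable section

open scoped ComplexConjugate InnerProductSpace Pointwise Topology

namespace Literature.RepresentationTheory.CompactGroups

open Literature.NumberTheory.Automorphic

variable {n : Type*} [Fintype n] [DecidableEq n]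

/-! ### Unitary matrices are semisimple -/

/-- **A unitary matrix is a semisimple element of `GL n ℂ`**: on `ℂⁿ` with its standard inner
product the map `x ↦ g x` preserves inner products, so the orthogonal complement of an invariant
subspace is invariant (Onishchik–Vinberg Ch. 3 §1; here through Mathlib's
`Module.End.isSemisimple_iff`). [folklore] -/
theorem isSemisimpleElt_of_mem_unitaryGroup {g : GL n ℂ}
    (hg : (g : Matrix n n ℂ) ∈ Matrix.unitaryGroup n ℂ) : IsSemisimpleElt g := by
  classical
  have hstar : star (g : Matrix n n ℂ) * (g : Matrix n n ℂ) = 1 := Matrix.mem_unitaryGroup_iff'.1 hg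
  -- the operator on Euclidean space and its unitarity
  set T : EuclideanSpace ℂ n →ₗ[ℂ] EuclideanSpace ℂ n := Matrix.toEuclideanLin (g : Matrix n n ℂ)
    with hTdef
  have hadj : T.adjoint = Matrix.toEuclideanLin (star (g : Matrix n n ℂ)) := by
    rw [hTdef, ← Matrix.toEuclideanLin_conjTranspose_eq_adjoint, Matrix.star_eq_conjTranspose]
  have hadjT : ∀ y, T.adjoint (T y) = y := by
    intro y
    rw [hadj, hTdef, Matrix.toLpLin_apply, Matrix.toLpLin_apply, WithLp.ofLp_toLp,
      Matrix.mulVec_mulVec, hstar, Matrix.one_mulVec, WithLp.toLp_ofLp]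
  have hinner : ∀ x y : EuclideanSpace ℂ n, ⟪T x, T y⟫_ℂ = ⟪x, y⟫_ℂ := by
    intro x y
    rw [← LinearMap.adjoint_inner_right, hadjT]
  have hTinj : Function.Injective T := by
    intro x y hxy
    have h : ⟪x - y, x - y⟫_ℂ = 0 := by
      rw [← hinner, map_sub, hxy, sub_self, inner_zero_left]
    exact sub_eq_zero.1 (inner_self_eq_zero.1 h)
  obtain ⟨Te, hTe⟩ : ∃ Te : EuclideanSpace ℂ n ≃ₗ[ℂ] EuclideanSpace ℂ n, (Te : _ →ₗ[ℂ] _) = T :=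
    ⟨LinearEquiv.ofBijective T ⟨hTinj, LinearMap.injective_iff_surjective.1 hTinj⟩, rfl⟩
  -- semisimplicity on Euclidean space
  have hT : Module.End.IsSemisimple T := by
    rw [Module.End.isSemisimple_iff]
    intro p hp
    rw [Module.End.mem_invtSubmodule, ← Submodule.map_le_iff_le_comap] at hp
    have hmap : Submodule.map T p = p := by
      refine Submodule.eq_of_le_of_finrank_eq hp ?_
      rw [← hTe]
      exact LinearEquiv.finrank_map_eq Te p
    refine ⟨pᗮ, ?_, Submodule.isCompl_orthogonal p⟩
    rw [Module.End.mem_invtSubmodule]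
    intro y hy
    rw [Submodule.mem_comap, Submodule.mem_orthogonal]
    intro x hx
    rw [← hmap] at hx
    obtain ⟨x', hx', rfl⟩ := hx
    rw [hinner]
    exact (Submodule.mem_orthogonal p y).1 hy x' hx'
  -- transfer to `Matrix.toLin'`
  unfold IsSemisimpleElt
  let e : (n → ℂ) ≃ₗ[ℂ] EuclideanSpace ℂ n := (WithLp.linearEquiv 2 ℂ (n → ℂ)).symm
  refine (LinearEquiv.isSemisimple_iff (Matrix.toLin' (g : Matrix n n ℂ)) T e ?_).2 hT
  ext v
  rfl

/-! ### Algebraic subgroups are Euclidean closed; Zariski closures of connected groups -/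

/-- The coordinates `g ↦ (g_{ij}, det(g)⁻¹)` are continuous on `GL n ℂ` (Euclidean topology).
[folklore] -/
theorem continuous_glCoordFun : Continuous fun g : GL n ℂ => glCoordFun g := by
  refine continuous_pi fun c => ?_
  rcases c with ⟨i, j⟩ | u
  · exact (Units.continuous_val.matrix_elem i j)
  · change Continuous fun g : GL n ℂ => (Matrix.det (g : Matrix n n ℂ))⁻¹
    exact (Units.continuous_val.matrix_det).inv₀ fun g => Matrix.GeneralLinearGroup.det_ne_zero g

/-- An algebraic subgroup of `GL n ℂ` is closed in the Euclidean topology (zero loci of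
polynomials in continuous coordinates). [folklore] -/
theorem isClosed_of_isAlgebraicSubgroup {K : Subgroup (GL n ℂ)} (hK : IsAlgebraicSubgroup K) :
    IsClosed (K : Set (GL n ℂ)) := by
  obtain ⟨S, hS⟩ := hK
  rw [hS]
  have : zeroLocusGL S = ⋂ p ∈ S, {g : GL n ℂ | MvPolynomial.eval (glCoordFun g) p = 0} := by
    ext g; simp [zeroLocusGL]
  rw [this]
  exact isClosed_biInter fun p _ =>
    isClosed_eq ((MvPolynomial.continuous_eval p).comp continuous_glCoordFun) continuous_const

/-- **The Zariski closure of a Euclidean-connected subgroup of `GL n ℂ` is Zariski connected.**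
An algebraic subgroup `K` of finite index in the closure `Ā` is Euclidean closed, hence (finite
index) clopen in `Ā`; the connected set `A ∋ 1` therefore lies in `K`, so `K = Ā`.
(Onishchik–Vinberg Ch. 3 §2; Springer 2.2.1.) [folklore] -/
theorem isZConnected_zariskiClosure_of_isPreconnected {A : Subgroup (GL n ℂ)}
    (hA : IsPreconnected (A : Set (GL n ℂ))) : IsZConnected (zariskiClosure A) := by
  refine ⟨isAlgebraicSubgroup_zariskiClosure A, fun K hKle hKalg hKfi => ?_⟩
  suffices hAK : A ≤ K from le_antisymm hKle (zariskiClosure_le hKalg hAK)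
  haveI := hKfi
  -- the finite-index subgroup is clopen in the closure (Euclidean topology)
  have hK'closed : IsClosed ((K.subgroupOf (zariskiClosure A) : Subgroup (zariskiClosure A)) :
      Set (zariskiClosure A)) :=
    (isClosed_of_isAlgebraicSubgroup hKalg).preimage continuous_subtype_val
  have hK'open : IsOpen ((K.subgroupOf (zariskiClosure A) : Subgroup (zariskiClosure A)) :
      Set (zariskiClosure A)) :=
    Subgroup.isOpen_of_isClosed_of_finiteIndex _ hK'closed
  -- the trace of `A` in the closure is preconnected and meets `K`
  have hApre : IsPreconnected
      ((Subtype.val : zariskiClosure A → GL n ℂ) ⁻¹' (A : Set (GL n ℂ))) := by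
    rw [← Topology.IsInducing.subtypeVal.isPreconnected_image]
    convert hA using 1
    exact Set.ext fun x => ⟨fun ⟨y, hy, hyx⟩ => hyx ▸ hy,
      fun hx => ⟨⟨x, le_zariskiClosure A hx⟩, hx, rfl⟩⟩
  have hsub := hApre.subset_isClopen ⟨hK'closed, hK'open⟩
    ⟨⟨1, (zariskiClosure A).one_mem⟩, A.one_mem, (K.subgroupOf (zariskiClosure A)).one_mem⟩
  intro a ha
  exact hsub (show (⟨a, le_zariskiClosure A ha⟩ : zariskiClosure A) ∈
    (Subtype.val : zariskiClosure A → GL n ℂ) ⁻¹' (A : Set (GL n ℂ)) from ha)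

/-! ### Self-adjointness -/

section Star

/-- The coordinate relabelling `x_{ij} ↦ x_{ji}`, `det⁻¹ ↦ det⁻¹` and coefficient conjugation:
for every polynomial `p` in the coordinates of `GL n ℂ`,
`p(g⋆) = conj (p⋆(g))` with `p⋆ = rename (conj p)`. [folklore] -/
theorem eval_glCoordFun_star (p : MvPolynomial (GLCoord n) ℂ) (g : GL n ℂ) :
    MvPolynomial.eval (glCoordFun (star g)) p =
      conj (MvPolynomial.eval (glCoordFun g)
        (MvPolynomial.rename (Sum.map Prod.swap id) (MvPolynomial.map (starRingEnd ℂ) p))) := by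
  have hcoord : glCoordFun (star g) = conj ∘ (glCoordFun g ∘ Sum.map Prod.swap id) := by
    funext c
    rcases c with ⟨i, j⟩ | u
    · simp only [glCoordFun_inl, Units.coe_star, Function.comp_apply, Sum.map_inl, Prod.swap_prod_mk,
        Matrix.star_apply, RCLike.star_def]
    · simp only [glCoordFun_inr, Units.coe_star, Function.comp_apply, Sum.map_inr, id_eq,
        Matrix.star_eq_conjTranspose, Matrix.det_conjTranspose, RCLike.star_def, map_inv₀]
  rw [hcoord, MvPolynomial.eval_rename, MvPolynomial.eval_map, MvPolynomial.eval₂_comp_left]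
  have hcc : (starRingEnd ℂ).comp (starRingEnd ℂ) = RingHom.id ℂ := RingHom.ext Complex.conj_conj
  rw [hcc]
  rfl

/-- **`g ↦ g⋆` is Zariski continuous on `GL n ℂ`** (the preimage of a zero locus is the zero
locus of the conjugated, transposed polynomials); the Zariski topology is the tree's
`zariskiTopologyGL`, supplied explicitly. [folklore] -/
theorem continuous_star_zariski :
    Continuous[zariskiTopologyGL n ℂ, zariskiTopologyGL n ℂ] (star : GL n ℂ → GL n ℂ) := by
  letI := zariskiTopologyGL n ℂ
  rw [continuous_iff_isClosed]
  intro Z hZ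
  obtain ⟨S, rfl⟩ := isClosed_zariski_iff.1 hZ
  rw [isClosed_zariski_iff]
  refine ⟨(fun p => MvPolynomial.rename (Sum.map Prod.swap id)
    (MvPolynomial.map (starRingEnd ℂ) p)) '' S, ?_⟩
  ext g
  simp only [Set.mem_preimage, zeroLocusGL, Set.mem_setOf_eq, Set.forall_mem_image]
  refine forall₂_congr fun p _ => ?_
  rw [eval_glCoordFun_star, map_eq_zero]

/-- The Zariski closure of a self-adjoint subgroup of `GL n ℂ` is self-adjoint. [folklore] -/
theorem star_mem_zariskiClosure {A : Subgroup (GL n ℂ)} (hA : ∀ a ∈ A, star a ∈ A) {x : GL n ℂ}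
    (hx : x ∈ zariskiClosure A) : star x ∈ zariskiClosure A := by
  letI := zariskiTopologyGL n ℂ
  exact image_closure_subset_of_isClosed continuous_star_zariski isClosed_closure
    (fun a ha => subset_closure (hA a ha)) hx

/-- A finite union of translates of an algebraic subgroup is a zero locus. [folklore] -/
theorem exists_zeroLocusGL_eq_biUnion_smul {S : Subgroup (GL n ℂ)} (hS : IsAlgebraicSubgroup S)
    (F : Finset (GL n ℂ)) :
    ∃ T : Set (MvPolynomial (GLCoord n) ℂ), (⋃ f ∈ F, f • (S : Set (GL n ℂ))) = zeroLocusGL T := by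
  letI := zariskiTopologyGL n ℂ
  exact isClosed_zariski_iff.1
    (isClosed_biUnion_finset fun f _ => isClosed_smul_zariski hS.isClosed f)

/-- A polynomial in the coordinates of `GL n` vanishing on a subgroup `A` vanishes on the Zariski
closure of `A` (zero loci are Zariski closed). [folklore] -/
theorem eval_eq_zero_of_mem_zariskiClosure {k : Type*} [Field k]
    {A : Subgroup (GL n k)} {p : MvPolynomial (GLCoord n) k}
    (hp : ∀ a ∈ A, MvPolynomial.eval (glCoordFun a) p = 0) {x : GL n k}
    (hx : x ∈ zariskiClosure A) : MvPolynomial.eval (glCoordFun x) p = 0 := by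
  letI := zariskiTopologyGL n k
  have hsub : (A : Set (GL n k)) ⊆ zeroLocusGL {p} := fun a ha q hq => by
    rw [Set.mem_singleton_iff.1 hq]; exact hp a ha
  exact (closure_minimal hsub (isClosed_zeroLocusGL _) hx) p rfl

end Star

omit [Fintype n] [DecidableEq n] in
/-- The centraliser of a self-adjoint subset of a `⋆`-monoid is self-adjoint (here in `GL n ℂ`).
[folklore] -/
theorem star_mem_centralizer [Fintype n] [DecidableEq n] {S : Set (GL n ℂ)}
    (hS : ∀ s ∈ S, star s ∈ S) {g : GL n ℂ} (hg : g ∈ Subgroup.centralizer S) :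
    star g ∈ Subgroup.centralizer S := by
  rw [Subgroup.mem_centralizer_iff] at hg ⊢
  intro s hs
  have h := congrArg star (hg (star s) (hS s hs))
  simp only [star_mul, star_star] at h
  exact h.symm

/-- For a unitary element of `GL n ℂ`, `g⋆ = g⁻¹`; in particular subgroups of unitary elements
are self-adjoint. [folklore] -/
theorem star_eq_inv_of_mem_unitaryGroup {g : GL n ℂ}
    (hg : (g : Matrix n n ℂ) ∈ Matrix.unitaryGroup n ℂ) : star g = g⁻¹ := by
  have h1 : (g : Matrix n n ℂ) * star (g : Matrix n n ℂ) = 1 := Matrix.mem_unitaryGroup_iff.1 hg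
  exact Units.ext ((Units.coe_star g).trans (Units.inv_eq_of_mul_eq_one_right h1).symm)

/-! ### The Zariski closure of a connected commutative unitary group is a torus -/

omit [DecidableEq n] in
/-- The Zariski closure of a commutative subgroup is commutative (`⁅Ā, Ā⁆ ≤ cl ⁅A, A⁆ = 1`,
Springer 2.2.4/2.2.8). [folklore] -/
theorem isMulCommutative_zariskiClosure [DecidableEq n] {k : Type*} [Field k]
    {A : Subgroup (GL n k)} [hA : IsMulCommutative A] : IsMulCommutative (zariskiClosure A) := by
  have h1 : ⁅A, A⁆ = ⊥ := by
    rw [Subgroup.commutator_eq_bot_iff_le_centralizer]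
    intro a ha
    rw [Subgroup.mem_centralizer_iff]
    intro b hb
    have := hA.is_comm.comm ⟨b, hb⟩ ⟨a, ha⟩
    exact congrArg Subtype.val this
  have h2 : ⁅zariskiClosure A, zariskiClosure A⁆ = ⊥ := by
    refine le_bot_iff.1 ((commutator_zariskiClosure_le A A).trans ?_)
    rw [h1, zariskiClosure_bot]
  have h3 := Subgroup.commutator_eq_bot_iff_le_centralizer.1 h2
  refine ⟨⟨fun x y => Subtype.ext ?_⟩⟩
  exact ((Subgroup.mem_centralizer_iff.1 (h3 x.2)) y y.2).symm

/-- **The Zariski closure of a connected commutative group of unitary matrices is a torus** of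
`GL n ℂ`: Zariski connected (`isZConnected_zariskiClosure_of_isPreconnected`), commutative, and
consisting of semisimple elements — `A`, a commutative group of semisimple (unitary) elements, is
conjugate into the diagonal torus `𝔻ₙ` (tree `exists_conj_le_diagonalSubgroup`, Springer 2.4.2),
an algebraic subgroup, which therefore contains `Ā`. [folklore] -/
theorem isTorusSubgroup_zariskiClosure {A : Subgroup (GL n ℂ)} [IsMulCommutative A]
    (hconn : IsPreconnected (A : Set (GL n ℂ)))
    (hU : ∀ a ∈ A, (a : Matrix n n ℂ) ∈ Matrix.unitaryGroup n ℂ) :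
    IsTorusSubgroup (zariskiClosure A) := by
  refine ⟨isZConnected_zariskiClosure_of_isPreconnected hconn, isMulCommutative_zariskiClosure, ?_⟩
  obtain ⟨g, hg⟩ := exists_conj_le_diagonalSubgroup (T := A) inferInstance
    (fun a ha => isSemisimpleElt_of_mem_unitaryGroup (hU a ha))
  -- `A ≤ g⁻¹ 𝔻ₙ g`, an algebraic subgroup
  set D' : Subgroup (GL n ℂ) := (diagonalSubgroup n ℂ).map (MulAut.conj g⁻¹).toMonoidHom
    with hD'
  have hD'alg : IsAlgebraicSubgroup D' := isAlgebraicSubgroup_diagonalSubgroup.map_conj g⁻¹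
  have hAD' : A ≤ D' := by
    intro a ha
    have hmem : (MulAut.conj g).toMonoidHom a ∈ diagonalSubgroup n ℂ := hg ⟨a, ha, rfl⟩
    refine ⟨_, hmem, ?_⟩
    simp only [MulEquiv.toMonoidHom_eq_coe, MonoidHom.coe_coe, MulAut.conj_apply, inv_inv]
    group
  intro t ht
  obtain ⟨d, hd, rfl⟩ := zariskiClosure_le hD'alg hAD' ht
  simpa only [MulEquiv.toMonoidHom_eq_coe, MonoidHom.coe_coe, MulAut.conj_apply] using
    (isSemisimpleElt_of_mem_diagonalSubgroup hd).conj g⁻¹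

end Literature.RepresentationTheory.CompactGroups

end
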